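import Summits.Ventures.PercRepro.GenQLargeGen

/-!
# PercRepro — THEOREM LARGE at rank `7`: the size chain of the `(9, 7)` core and `μ₇` (night-4, gen 7)

The instance `q = 7` of `GenQLargeGen`: on a Core matroid with `f(4) ≤ 10` the size chain is
`fSeven = 3, 3, 3, 6, 10, 21, 43` (`sizeChain_seven_of_core`: ranks `≤ 2` by `card_le_three_of_eRk_le_two'`, `3 … 5` by
`CoreHyps`, `6` by `card_le_fortythree_of_core_of_ten`), and the coloop count by size is the explicit
`mu7 = 7, 5, 4, 3, 2, 1, 0` on `j ≤ 7, = 8, ≤ 10, ≤ 13, ≤ 23, ≤ 44, ≥ 45` (`muQ_seven`, by `decide` up to `44` and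
`muQ_eq_zero_of_forall` beyond).  The numerics `0 ≤ lbSumQ 7 fSeven t n` (`44 ≤ n ≤ 87` at `t = 3, 4, 5`;
`47 ≤ n ≤ 87` at `t = 6`) are `GenQLargeSevenNumA … D`; the theorem of the cell, `jq_nonneg_of_large_seven`, is in `NumD`.
Imports `GenQLargeGen`.
-/
namespace PercRepro.Night4

open Finset ThmH SixFour GenQ PerFlat Star NightThree

variable {α : Type} [DecidableEq α] {M : Matroid α} [M.Finite]

/-- The size chain of the `(9, 7)` core: `3, 3, 3, 6, 10, 21, 43` at `r = 0 … 6`. -/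
def fSeven (r : ℕ) : ℕ :=
  if r ≤ 2 then 3 else if r = 3 then 6 else if r = 4 then 10 else if r = 5 then 21 else 43

/-- **The size chain of the `(9, 7)` core**: a Core matroid with `f(4) ≤ 10`. -/
theorem sizeChain_seven_of_core {p : ℕ} (hc : Core M p) (h10 : ∀ F ∈ flatsQ M 4, F.card ≤ 10) :
    SizeChain M 7 fSeven := by
  have hh := coreHyps_of_core hc h10
  have h6 := sizeChain_six_of_coreHyps hh
  intro X hX r hr hrk
  by_cases hr6 : r < 6
  · have := h6 X hX r hr6 hrk
    unfold fSix at this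
    unfold fSeven
    interval_cases r <;> simpa using this
  · have hr6' : r = 6 := by omega
    subst hr6'
    show X.card ≤ 43
    obtain ⟨r', hr'⟩ := exists_eRk_eq_nat (M := M) X
    have hr'6 : r' ≤ 6 := by
      rw [hr'] at hrk
      exact_mod_cast hrk
    by_cases hlt : r' < 6
    · have := h6 X hX r' hlt (le_of_eq hr')
      unfold fSix at this
      interval_cases r' <;> simp at this <;> omega
    · have hr'' : r' = 6 := by omega
      rw [hr''] at hr'
      have hF := clF_mem_flatsQ (M := M) hr'
      exact (Finset.card_le_card (subset_clF (M := M) hX)).trans (card_le_fortythree_of_core_of_ten hc h10 hF)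

/-- `μ(j) = 0` when no coloop count `1 ≤ m ≤ q − 2` fits the size `j > q`. -/
theorem muQ_eq_zero_of_forall {q : ℕ} {f : ℕ → ℕ} {j : ℕ} (hj : q < j)
    (h : ∀ m, 1 ≤ m → m ≤ q - 2 → m + f (q - m) < j) : muQ q f j = 0 := by
  unfold muQ
  rw [if_neg (by omega)]
  apply Nat.eq_zero_of_le_zero
  apply Finset.sup_le
  intro m hm
  rw [Finset.mem_filter, Finset.mem_Icc] at hm
  have := h m hm.1.1 hm.1.2
  omega

/-- `μ₇(j)` explicitly: `7, 5, 4, 3, 2, 1, 0` on `j ≤ 7, = 8, ≤ 10, ≤ 13, ≤ 23, ≤ 44, ≥ 45`. -/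
def mu7 (j : ℕ) : ℕ :=
  if j ≤ 7 then 7 else if j ≤ 8 then 5 else if j ≤ 10 then 4 else if j ≤ 13 then 3 else if j ≤ 23 then 2
  else if j ≤ 44 then 1 else 0

/-- **`μ(j) = μ₇(j)`** for the chain `fSeven`, at every `j`. -/
theorem muQ_seven (j : ℕ) : muQ 7 fSeven j = mu7 j := by
  by_cases hj : j ≤ 44
  · interval_cases j <;> decide
  · rw [muQ_eq_zero_of_forall (by omega)]
    · unfold mu7
      simp only [show ¬ j ≤ 7 by omega, show ¬ j ≤ 8 by omega, show ¬ j ≤ 10 by omega, show ¬ j ≤ 13 by omega,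
        show ¬ j ≤ 23 by omega, show ¬ j ≤ 44 by omega, if_false]
    · intro m hm1 hm2
      unfold fSeven
      interval_cases m <;> simp <;> omega

end PercRepro.Night4
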